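import Literature.NumberTheory.Sieve.MatomakiRadziwillLemma4LipschitzOfCentral4
import Literature.NumberTheory.LFunctions.GranvilleSoundararajanTheorem4Proofs
import HarnessLib

/-!
# Granville–Soundararajan 2003, Corollary 3: the discharge

Topic `Literature/NumberTheory/LFunctions`.  Everything here is PROVED; no definitions, no named facts.

The named fact `GranvilleSoundararajan2003_corollary3` (`GranvilleSoundararajan2003.lean`; A. Granville,
K. Soundararajan, *Decay of mean values of multiplicative functions*, Canad. J. Math. 55 (2003),
Corollary 3: for real multiplicative `f` with `|f| ≤ 1`,
`(1/x) ∑_{n ≤ x} f(n) = (1/x^{1+it₁}) ∑_{n ≤ x} f(n) n^{it₁}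
  + O((log log x)^{1+2(1-2/π)}/(log x)^{1-2/π} + exp(-c √(log log x)))`)
is reduced in the tree to Theorem 4 of the same paper for central maximisers
(`GranvilleSoundararajan2003_corollary3_of_central4`, `GranvilleSoundararajanCorollary3.lean`, through
`MatomakiRadziwillL4A.corollary3_of_theorem4_central`, `MatomakiRadziwillLemma4LipschitzOfCentral4.lean`), and
that form of Theorem 4 is proved (`GranvilleSoundararajan2003_theorem4_central_holds`,
`GranvilleSoundararajanTheorem4Proofs.lean`).  This file records the resulting discharge

* `GranvilleSoundararajan2003_corollary3_holds : GranvilleSoundararajan2003_corollary3`.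

## References
* A. Granville, K. Soundararajan, *Decay of mean values of multiplicative functions*, Canad. J. Math. 55
  (2003), 1191–1230: Corollary 3 and its proof in §7; Theorem 4 and §6. [GranvilleSoundararajan2003]
-/

namespace Literature.NumberTheory.LFunctions

namespace GranvilleSoundararajan

/-- **Granville–Soundararajan 2003, Corollary 3**, PROVED: the printed deduction of §7 from Theorem 1,
Lemma 2.3, Theorem 3, Theorem 4 (for central maximisers, `GranvilleSoundararajan2003_theorem4_central_holds`)
and Lemma 7.1, all of which are theorems of the tree.
[cite: GranvilleSoundararajan2003, Corollary 3 and §7] -/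
theorem GranvilleSoundararajan2003_corollary3_holds : GranvilleSoundararajan2003_corollary3 :=
  Literature.NumberTheory.Sieve.MatomakiRadziwillL4A.corollary3_of_theorem4_central
    GranvilleSoundararajan2003_theorem4_central_holds

end GranvilleSoundararajan

end Literature.NumberTheory.LFunctions
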